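/-
Copyright (c) 2026. Released under Apache 2.0 license as described in the file LICENSE.
-/
import Literature.NumberTheory.LFunctions.Xiao2020.KeiperLiTaylor
import Literature.NumberTheory.LFunctions.Xiao2020.CertTables
import Literature.NumberTheory.LFunctions.Xiao2020.Certificate
import HarnessLib

/-!
# Xiao (2020), Conj. 3.4 is false: the Keiper–Li coefficients are not convex at `n = 119`

[Xiao2020, Conj. 3.4] asserts: for all `n ≥ 3`, `λₙ > 2λₙ₋₁ − λₙ₋₂`, where `λₙ` are the
Keiper–Li coefficients in Li's normalisation (Li 1997, eq. (1.4) — the one Xiao uses in his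
Theorems 2.1, 3.2 and Conj. 3.4; Keiper's power-series coefficients are `λₙ/n`),
`λₙ = (1/(n−1)!) · dⁿ/dsⁿ [s^{n−1} log ξ(s)]_{s=1}` [Li1997], [Keiper1992] — here the tree
declaration `Literature.NumberTheory.LFunctions.keiperLiCoeff`.  The integer-interval certificate
`CertKernel.cert` (evaluated by the kernel in `Xiao2020.Certificate`) shows that the inequality
holds for `3 ≤ n ≤ 118` and fails at `n = 119`: `λ₁₁₉ − 2λ₁₁₈ + λ₁₁₇ ≈ −2.7104·10⁻⁴ < 0`.
Everything is kernel-checked from Mathlib's `riemannZeta` with the standard axioms; the analytic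
inputs are the Euler–Maclaurin formula with explicit remainder (`N = 40`, `ν = 25`) and the Cauchy
estimate on `|w| = 9/10`.

## Part 1. Soundness of the certificate, III (continuing `Xiao2020.CertEnclosure`, `Xiao2020.CertTables`)

(The module docstrings of `Xiao2020.CertKernel`, `.CertEnclosure`, `.Certificate` call this part
`Xiao2020.CertSound`; it lives in the present file.)

What the assembled programs of `Xiao2020.CertKernel` enclose (all at scale `SC = 2¹⁷⁶`):

1. `uList` ⊇ `uᵢ = Re [wⁱ] ζ₁(1+w)` (`0 ≤ i ≤ 119`): boxes of the coefficients of the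
   Euler–Maclaurin exponential polynomial `P_{40,25}` widened by the Cauchy bound `r·B/rⁱ`,
   `r = 9/10` (`Xiao2020.norm_zetaOneTaylor_sub_emMainOneCoeff_le`);
2. `qList` ⊇ `q_m = Re [wᵐ](ζ₁'/ζ₁)(1+w)` (`Xiao2020.sum_zetaOneTaylorCoeff_mul`);
3. `aList` ⊇ `aₖ = Re [wᵏ] log ξ(1+w)`, `k ≥ 2` (`Xiao2020.logXiTaylorCoeff_succ`, `mem_zetaBox`);
4. `dList` ⊇ `dₙ = Σₖ k (C(n,k) − 2C(n−1,k) + C(n−2,k)) aₖ = λₙ − 2λₙ₋₁ + λₙ₋₂`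
   (`Xiao2020.keiperLiCoeff_eq_sum_logXiTaylorCoeff`; the weights of `a₀, a₁` vanish);

ending in `CertKernel.cert_sound : cert = true → λ₁₁₉ − 2λ₁₁₈ + λ₁₁₇ < 0 ∧
∀ n, 3 ≤ n → n ≤ 118 → 0 < λₙ − 2λₙ₋₁ + λₙ₋₂`.

## Part 2. The refutation: `keiperLiCoeff_119_lt`, `keiperLiCoeff_convex_of_le`, `not_xiao_conj_3_4`
(the printed sentence, negated), `isLeast_keiperLi_convexity_failure` (`119` is the least failing
`n`).  References: [Xiao2020, Conj. 3.4]; [Keiper1992]; Li's criterion [Li1997].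
-/

namespace Literature.NumberTheory.LFunctions.Xiao2020

open Literature.Analysis.ValidatedNumerics Literature.Analysis.ValidatedNumerics.NumericsMP Finset
open scoped Nat

namespace CertKernel

variable {S : ℕ}

/-! ### `uList`: boxes of the Taylor coefficients `uᵢ` of `ζ₁` at `1` -/

/-- [folklore] -/
lemma encl_replicate_zeroI (S n : ℕ) : Encl S (fun _ ↦ (0 : ℝ)) (List.replicate n zeroI) := by
  induction n with
  | zero => trivial
  | succ n ih => exact ⟨mem_zeroI S, ih⟩

/-- [folklore] -/
lemma encl_tail {f : ℕ → ℝ} {L : List MI} (h : Encl S f L) : Encl S (fun j ↦ f (j + 1)) L.tail := by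
  cases L with
  | nil => trivial
  | cons I L => exact h.2

/-- [folklore] -/
lemma sum_range_min (f : ℕ → ℝ) (a m : ℕ) :
    ∑ l ∈ Finset.range (min a m), f l = ∑ l ∈ Finset.range a, if l < m then f l else 0 := by
  rw [Finset.sum_ite, Finset.sum_const_zero, add_zero]
  congr 1
  ext l
  simp [Finset.mem_filter]

/-- [folklore] -/
lemma length_gList (S : ℕ) (cs : List ℚ) (N ν : ℕ) : (gList S cs N ν).length = 2 * ν := by
  simp [gList]

/-- [folklore] -/
lemma gCoeffQ_cast {cs : List ℚ} {N ν : ℕ} (hcs : ∀ j < ν, cs.getD (j + 1) 0 = ZetaNumerics.emCoeff (j + 1))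
    (l : ℕ) : ((gCoeffQ cs (pochRows ν) N ν l : ℚ) : ℝ) = gCoeffR N ν l := by
  rw [gCoeffQ, gCoeffR, ← Finset.Ico_add_one_right_eq_Icc, Finset.sum_Ico_eq_sum_range,
    Nat.add_sub_cancel]
  push_cast
  refine Finset.sum_congr rfl fun j hj ↦ ?_
  rw [Finset.mem_range] at hj
  rw [hcs j hj, pochRows_getD hj, ZetaNumerics.emCoeff, show 1 + j = j + 1 by omega]
  push_cast
  ring

/-- [folklore] -/
lemma encl_gList (S : ℕ) {cs : List ℚ} {N ν : ℕ}
    (hcs : ∀ j < ν, cs.getD (j + 1) 0 = ZetaNumerics.emCoeff (j + 1)) :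
    Encl S (fun l ↦ gCoeffR N ν l) (gList S cs N ν) := by
  rw [encl_iff_getD]
  intro l hl
  rw [length_gList] at hl
  have : (gList S cs N ν).getD l zeroI = ratBox S (gCoeffQ cs (pochRows ν) N ν l) := by
    rw [gList, List.getD_eq_getElem?_getD, List.getElem?_map, List.getElem?_range hl]
    simp
  rw [this, ← gCoeffQ_cast hcs]
  exact mem_ratBox S _

/-- [folklore] -/
lemma emCoeffList_getD_succ {ν j : ℕ} (hj : j < ν) :
    (ZetaNumerics.emCoeffList ν).getD (j + 1) 0 = ZetaNumerics.emCoeff (j + 1) :=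
  ZetaNumerics.emCoeffList_getD (by omega)

/-- [folklore] -/
lemma tailBoundQ_cast (N ν : ℕ) (r : ℚ) : ((tailBoundQ N ν r : ℚ) : ℝ) = emTailBound N ν (r : ℝ) := by
  simp only [tailBoundQ, emTailBound]
  push_cast
  rfl

/-- The real Taylor coefficients `uᵢ = Re [wⁱ]ζ₁(1+w)`. [folklore] -/
noncomputable def uR (i : ℕ) : ℝ := (zetaOneTaylorCoeff i).re

/-- What `uList` computes. [folklore] -/
theorem uList_spec {U : List MI} (h : uList = some U) :
    U.length = IMAX + 1 ∧ Encl SC uR U := by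
  unfold uList at h
  split at h
  · rename_i Ls LN hLs hLN
    simp only [Option.some.injEq] at h
    subst h
    have hS : 0 < SC := by simp [SC]
    obtain ⟨hLsl, hLse⟩ := logsList_spec hS KLOG (N - 1) Ls hLs
    have hLNm : MI.mem SC (Real.log N) LN := MI.mem_logNat hS hLN
    -- the four parts
    have hA := encl_aPass hS IMAX Ls 1 (List.replicate (IMAX + 1) zeroI) (fun _ ↦ 0) le_rfl
      (hLse.congr' fun i ↦ by simp [add_comm]) (encl_replicate_zeroI SC (IMAX + 1))
    have hAl := length_aPass SC IMAX Ls 1 (List.replicate (IMAX + 1) zeroI) (by simp)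
    have hrow := encl_trow hS (MI.mem_neg hLNm) (IMAX + 1)
    have hC : Encl SC (fun i ↦ (2 * N : ℝ)⁻¹ * expMonCoeffR 1 (-Real.log N) i)
        (zeroI :: (trow SC LN.neg (IMAX + 1)).map fun t ↦ t.divNat (2 * N)) := by
      refine ⟨by simpa [expMonCoeffR] using mem_zeroI SC, ?_⟩
      have := encl_map_divNat hrow (n := 2 * N) (by simp [N])
      refine this.congr' fun i ↦ ?_
      simp only [expMonCoeffR, show 1 ≤ i + 1 from by omega, if_true, Nat.add_sub_cancel]
      push_cast
      ring
    have hG := encl_gList SC (N := N) (ν := NU) (cs := ZetaNumerics.emCoeffList NU)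
      (fun j hj ↦ emCoeffList_getD_succ hj)
    have hD := encl_dPass hS hG (fun m ↦ (-Real.log N) ^ m / m !) (trow SC LN.neg (IMAX + 1)) [] 0
      (hrow.congr' fun m ↦ by simp) rfl trivial
    have hP := encl_addL (encl_addL (encl_addL hA hrow) hC) hD
    -- identify with `emMainOneCoeffR`
    have hP' : Encl SC (fun i ↦ emMainOneCoeffR N NU i)
        (addL (addL (addL (aPass SC IMAX Ls 1 (List.replicate (IMAX + 1) zeroI))
          (trow SC LN.neg (IMAX + 1)))
          (zeroI :: (trow SC LN.neg (IMAX + 1)).map fun t ↦ t.divNat (2 * N)))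
          (dPass SC (gList SC (ZetaNumerics.emCoeffList NU) N NU) (trow SC LN.neg (IMAX + 1)) [])) := by
      refine hP.congr' fun i ↦ ?_
      rw [emMainOneCoeffR_eq, hLsl, show 1 + (N - 1) = N from by simp [N], zero_add, length_gList,
        zero_add, sum_range_min]
      congr 1
      refine Finset.sum_congr rfl fun l hl ↦ ?_
      simp only [expMonCoeffR]
      split_ifs with h1 h2 h2
      · rw [show i - (l + 1) = i - 1 - l from by omega]
      · omega
      · omega
      · simp
    have hPl : (addL (addL (addL (aPass SC IMAX Ls 1 (List.replicate (IMAX + 1) zeroI))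
          (trow SC LN.neg (IMAX + 1)))
          (zeroI :: (trow SC LN.neg (IMAX + 1)).map fun t ↦ t.divNat (2 * N)))
          (dPass SC (gList SC (ZetaNumerics.emCoeffList NU) N NU) (trow SC LN.neg (IMAX + 1)) [])).length
          = IMAX + 1 := by
      simp [hAl]
    refine ⟨by simpa using hPl, ?_⟩
    refine encl_widenPass SC _ _ uR _ _ hP' fun i _ ↦ ?_
    have hb := norm_zetaOneTaylor_sub_emMainOneCoeff_le (N := N) (ν := NU) (by simp [N])
      (by simp [NU]) (r := (rQ : ℝ)) (by simp [rQ]) (by simp [rQ]; norm_num) i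
    have hre : |uR i - emMainOneCoeffR N NU i| ≤
        ‖iteratedDeriv i riemannZeta₁ 1 / (i ! : ℂ) - emMainOneCoeff N NU i‖ := by
      rw [uR, ← emMainOneCoeff_re, ← Complex.sub_re]
      exact Complex.abs_re_le_norm _
    refine hre.trans (hb.trans_eq ?_)
    rw [Rat.cast_mul, Rat.cast_mul, tailBoundQ_cast, Rat.cast_pow, Rat.cast_inv, inv_pow,
      div_eq_mul_inv]
  · exact absurd h (by simp)

/-! ### `qList`: boxes of `Re q_m` -/

/-- `q_m = Re [wᵐ](ζ₁'/ζ₁)(1+w)`. [folklore] -/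
noncomputable def qR (m : ℕ) : ℝ := (zetaOneLogDerivCoeff m).re

/-- The recursion `q_m = (m+1)u_{m+1} − Σ_{i=1}^{m} uᵢ q_{m−i}` on real parts. [folklore] -/
theorem qR_rec (m : ℕ) :
    qR m = (m + 1) * uR (m + 1) - ∑ i ∈ Finset.range m, uR (i + 1) * qR (m - 1 - i) := by
  have h := sum_zetaOneTaylorCoeff_mul m
  rw [Finset.sum_range_succ', zetaOneTaylorCoeff_zero, one_mul, Nat.sub_zero] at h
  have h' : zetaOneLogDerivCoeff m = ((m : ℂ) + 1) * zetaOneTaylorCoeff (m + 1) -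
      ∑ i ∈ Finset.range m, zetaOneTaylorCoeff (i + 1) * zetaOneLogDerivCoeff (m - (i + 1)) := by
    rw [← h]; ring
  rw [qR, h', Complex.sub_re, Complex.re_sum]
  congr 1
  · rw [show ((m : ℂ) + 1) = ((m + 1 : ℝ) : ℂ) by push_cast; rfl, Complex.re_ofReal_mul, uR]
  · refine Finset.sum_congr rfl fun i _ ↦ ?_
    rw [Complex.mul_re, zetaOneTaylorCoeff_im, zero_mul, sub_zero, uR, qR,
      show m - (i + 1) = m - 1 - i by omega]

/-- What `qList` computes. [folklore] -/
theorem qList_spec {U : List MI} (hU : Encl SC uR U) (hUl : U.length = IMAX + 1) :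
    (qList U).length = IMAX ∧ Encl SC qR (qList U) := by
  have hS : 0 < SC := by simp [SC]
  have htail : Encl SC (fun i ↦ uR (i + 1)) U.tail := encl_tail hU
  have htl : U.tail.length = IMAX := by simp [hUl]
  obtain ⟨hl, he⟩ := qPass_spec hS qR_rec htail IMAX U.tail 0 [] (htail.congr' fun i ↦ by
      show uR (i + 1) = uR (0 + 1 + i); rw [Nat.zero_add, Nat.add_comm])
    (by omega) (by omega) rfl trivial
  refine ⟨by simp [qList, hl], ?_⟩
  rw [qList]
  refine (encl_reverse he).congr fun i hi ↦ ?_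
  rw [List.length_reverse, hl] at hi
  rw [hl, show 0 + IMAX - 1 - (0 + IMAX - 1 - i) = i by omega]

/-! ### `aList`: boxes of `Re aₖ` -/

/-- `aₖ = Re [wᵏ] log ξ(1+w)` (all `aₖ` are real). [folklore] -/
noncomputable def aR (k : ℕ) : ℝ := (logXiTaylorCoeff k).re

/-- `aₖ` with `a₀, a₁` replaced by `0` (they do not enter the second differences). [folklore] -/
noncomputable def aR' (k : ℕ) : ℝ := if k < 2 then 0 else aR k

/-- `k aₖ = q_{k−1} + (−1)^{k−1}(1 − (1 − 2^{−k}) ζ(k))` for `k ≥ 2`, on real parts. [folklore] -/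
theorem aR_eq {k : ℕ} (hk : 2 ≤ k) :
    aR k = (qR (k - 1) + (-1) ^ (k - 1) * (1 - (1 - 1 / 2 ^ k) * (riemannZeta (k : ℂ)).re)) / k := by
  obtain ⟨j, rfl⟩ : ∃ j, k = j + 1 := ⟨k - 1, by omega⟩
  have h := logXiTaylorCoeff_succ (k := j) (by omega)
  simp only [Nat.add_sub_cancel]
  have hre := congrArg Complex.re h
  rw [show ((j : ℂ) + 1) = ((j + 1 : ℝ) : ℂ) by push_cast; rfl, Complex.re_ofReal_mul,
    Complex.add_re, show ((-1 : ℂ) ^ j) = (((-1 : ℝ) ^ j : ℝ) : ℂ) by push_cast; rfl,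
    Complex.re_ofReal_mul, Complex.sub_re, Complex.one_re,
    show (1 - 1 / 2 ^ (j + 1) : ℂ) = ((1 - 1 / 2 ^ (j + 1) : ℝ) : ℂ) by push_cast; rfl,
    Complex.re_ofReal_mul] at hre
  rw [aR, qR, eq_div_iff (by positivity)]
  push_cast at hre ⊢
  linarith

/-- [folklore] -/
theorem mem_aBox {Q : List MI} (hQ : Encl SC qR Q) (hQl : Q.length = IMAX) {k : ℕ}
    (hk : k < IMAX + 1) : MI.mem SC (aR' k) (aBox SC (ZetaNumerics.emCoeffList NU) N NU Q k) := by
  unfold aBox aR'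
  dsimp only
  split_ifs with h2 hpar
  · exact mem_zeroI SC
  all_goals
    have hZ := mem_zetaBox SC (Nn := N) (ν := NU) (k := k) (by simp [N]) (by simp [NU]) (by omega)
      (cs := ZetaNumerics.emCoeffList NU) (fun j hj ↦ emCoeffList_getD_succ hj)
      (by simp [ZetaNumerics.emCoeffList])
    have hq := hQ.getD (i := k - 1) (by omega)
    have hV := MI.mem_sub (MI.mem_ofInt SC 1)
      (MI.mem_sub hZ (MI.mem_divNat hZ (n := 2 ^ k) (by positivity)))
  · have := MI.mem_divNat (MI.mem_add hq hV) (n := k) (by omega)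
    convert this using 1
    rw [aR_eq (by omega), Even.neg_one_pow (Nat.even_iff.2 (by omega))]
    push_cast
    ring
  · have := MI.mem_divNat (MI.mem_add hq (MI.mem_neg hV)) (n := k) (by omega)
    convert this using 1
    rw [aR_eq (by omega), Odd.neg_one_pow (Nat.odd_iff.2 (by omega))]
    push_cast
    ring

/-- What `aList` computes. [folklore] -/
theorem aList_spec {Q : List MI} (hQ : Encl SC qR Q) (hQl : Q.length = IMAX) :
    (aList Q).length = IMAX + 1 ∧ Encl SC aR' (aList Q) := by
  refine ⟨by simp [aList], ?_⟩
  have := encl_tabulate (S := SC) (B := IMAX + 1) (fun k hk ↦ mem_aBox hQ hQl hk) 0 (IMAX + 1)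
    le_rfl
  simpa [aList] using this

/-! ### `dList`: the second differences -/

/-- `dₙ` as computed: `Σ_{k ≤ IMAX} k (C(n,k) − 2C(n−1,k) + C(n−2,k)) a'_k`. [folklore] -/
noncomputable def dR (n : ℕ) : ℝ := ∑ k ∈ Finset.range (IMAX + 1), (eW n k : ℝ) * aR' k

/-- What `dList` computes. [folklore] -/
theorem dList_spec {A : List MI} (hA : Encl SC aR' A) (hAl : A.length = IMAX + 1) :
    (dList A).length = IMAX - 1 ∧ Encl SC (fun j ↦ dR (2 + j)) (dList A) := by
  refine ⟨by simp [dList], ?_⟩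
  have h0 := rowIs_row0 IMAX
  have h1 := rowIs_pascalNext h0
  have h2 := rowIs_pascalNext h1
  have := encl_dSeq hA hAl (IMAX - 1) 2 _ _ _ le_rfl (by simpa using h0) (by simpa using h1)
    (by simpa using h2)
  simpa [dList, dR] using this

/-- `λₘ = Σ_{1 ≤ k ≤ IMAX} k C(m,k) aₖ` for `1 ≤ m ≤ IMAX`. [cite: Xiao2020, §3] -/
theorem keiperLiCoeff_eq_sum_aR {m : ℕ} (hm : 1 ≤ m) (hm' : m ≤ IMAX) :
    keiperLiCoeff m = ∑ k ∈ Finset.range (IMAX + 1), ((k : ℝ) * (m.choose k : ℝ)) * aR k := by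
  have hsub : ∑ j ∈ Finset.range m,
      ((m.choose (j + 1) * (j + 1) : ℕ) : ℝ) * (logXiTaylorCoeff (j + 1)).re =
      ∑ j ∈ Finset.range IMAX, ((m.choose (j + 1) * (j + 1) : ℕ) : ℝ) * (logXiTaylorCoeff (j + 1)).re :=
    Finset.sum_subset (Finset.range_subset_range.2 hm') fun j _ hj ↦ by
      rw [Finset.mem_range, not_lt] at hj
      rw [Nat.choose_eq_zero_of_lt (by omega)]
      simp
  rw [keiperLiCoeff_eq_sum_logXiTaylorCoeff hm, hsub, Finset.sum_range_succ']
  simp only [Nat.cast_zero, zero_mul, add_zero]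
  refine Finset.sum_congr rfl fun j _ ↦ ?_
  rw [aR]
  push_cast
  ring

/-- For `3 ≤ n ≤ IMAX` the computed `dₙ` is the second difference of the Keiper–Li coefficients
(the weights of `a₀, a₁` vanish). [cite: Xiao2020, Conj. 3.4] -/
theorem dR_eq {n : ℕ} (hn : 3 ≤ n) (hn' : n ≤ IMAX) :
    dR n = keiperLiCoeff n - 2 * keiperLiCoeff (n - 1) + keiperLiCoeff (n - 2) := by
  rw [keiperLiCoeff_eq_sum_aR (by omega) hn', keiperLiCoeff_eq_sum_aR (by omega) (by omega),
    keiperLiCoeff_eq_sum_aR (by omega) (by omega), dR, Finset.mul_sum, ← Finset.sum_sub_distrib,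
    ← Finset.sum_add_distrib]
  refine Finset.sum_congr rfl fun k _ ↦ ?_
  by_cases hk : k < 2
  · rw [aR', if_pos hk]
    interval_cases k
    · simp [eW]
    · simp only [mul_zero, Nat.choose_one_right, Nat.cast_one, one_mul]
      rw [Nat.cast_sub (by omega : 1 ≤ n), Nat.cast_sub (by omega : 2 ≤ n)]
      push_cast
      ring
  · rw [aR', if_neg hk, eW]
    push_cast
    ring

/-! ### The soundness theorem -/

/-- **Soundness of the certificate.** If the kernel evaluates `cert` to `true`, then
`λ₁₁₉ − 2λ₁₁₈ + λ₁₁₇ < 0` and `λₙ − 2λₙ₋₁ + λₙ₋₂ > 0` for `3 ≤ n ≤ 118`, for the Keiper–Li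
coefficients `λₙ = keiperLiCoeff n`. [cite: Xiao2020, Conj. 3.4] -/
theorem cert_sound (h : cert = true) :
    keiperLiCoeff 119 - 2 * keiperLiCoeff 118 + keiperLiCoeff 117 < 0 ∧
    ∀ n, 3 ≤ n → n ≤ 118 →
      0 < keiperLiCoeff n - 2 * keiperLiCoeff (n - 1) + keiperLiCoeff (n - 2) := by
  unfold cert at h
  split at h
  · exact absurd h (by simp)
  · rename_i U hU
    obtain ⟨hUl, hUe⟩ := uList_spec hU
    obtain ⟨hQl, hQe⟩ := qList_spec hUe hUl
    obtain ⟨hAl, hAe⟩ := aList_spec hQe hQl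
    obtain ⟨hDl, hDe⟩ := dList_spec hAe hAl
    have hT : Encl SC (fun j ↦ dR (3 + j)) (dList (aList (qList U))).tail :=
      (encl_tail hDe).congr' fun j ↦ by
        show dR (2 + (j + 1)) = dR (3 + j)
        rw [show 2 + (j + 1) = 3 + j by omega]
    have hTl : (dList (aList (qList U))).tail.length = IMAX - 2 := by simp [hDl, IMAX]
    obtain ⟨hpos, hneg, hlen⟩ := checkD_spec NNEG _ 3 h (by simp [NNEG])
    refine ⟨?_, fun n h3 h118 ↦ ?_⟩
    · have := MI.neg_of_hi_neg (hT.getD hlen) hneg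
      rw [show 3 + (NNEG - 3) = 119 from rfl, dR_eq (by norm_num) (by simp [IMAX])] at this
      exact this
    · have hi : n - 3 < (dList (aList (qList U))).tail.length := by
        rw [hTl]; simp only [IMAX]; omega
      have := MI.pos_of_lo_pos (hT.getD hi) (hpos (n - 3) (by simp only [NNEG]; omega))
      rw [show 3 + (n - 3) = n by omega, dR_eq h3 (by simp only [IMAX]; omega)] at this
      exact this

end CertKernel

/-! ## Part 2. The refutation -/

/-- `λ₁₁₉ < 2λ₁₁₈ − λ₁₁₇`: convexity of the Keiper–Li coefficients fails at `n = 119`.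
[cite: Xiao2020, Conj. 3.4] -/
theorem keiperLiCoeff_119_lt : keiperLiCoeff 119 < 2 * keiperLiCoeff 118 - keiperLiCoeff 117 := by
  have := (CertKernel.cert_sound CertKernel.cert_true).1
  linarith

/-- Convexity `λₙ > 2λₙ₋₁ − λₙ₋₂` does hold for `3 ≤ n ≤ 118`. [cite: Xiao2020, Conj. 3.4] -/
theorem keiperLiCoeff_convex_of_le {n : ℕ} (h3 : 3 ≤ n) (h118 : n ≤ 118) :
    2 * keiperLiCoeff (n - 1) - keiperLiCoeff (n - 2) < keiperLiCoeff n := by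
  have := (CertKernel.cert_sound CertKernel.cert_true).2 n h3 h118
  linarith

/-- **Refutation of [Xiao2020, Conj. 3.4]** ("for all `n ≥ 3` one has `λₙ > 2λₙ₋₁ − λₙ₋₂`"):
the claim fails at `n = 119`. [cite: Xiao2020, Conj. 3.4] -/
theorem not_xiao_conj_3_4 :
    ¬ ∀ n : ℕ, 3 ≤ n → 2 * keiperLiCoeff (n - 1) - keiperLiCoeff (n - 2) < keiperLiCoeff n := by
  intro h
  have h119 := h 119 (by norm_num)
  norm_num at h119
  linarith [keiperLiCoeff_119_lt]

/-- `119` is the least `n ≥ 3` at which `λₙ ≤ 2λₙ₋₁ − λₙ₋₂`. [cite: Xiao2020, Conj. 3.4] -/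
theorem isLeast_keiperLi_convexity_failure :
    IsLeast {n : ℕ | 3 ≤ n ∧ keiperLiCoeff n ≤ 2 * keiperLiCoeff (n - 1) - keiperLiCoeff (n - 2)}
      119 := by
  refine ⟨⟨by norm_num, ?_⟩, fun n hn ↦ ?_⟩
  · norm_num
    exact keiperLiCoeff_119_lt.le
  · by_contra hlt
    have := keiperLiCoeff_convex_of_le hn.1 (by omega)
    linarith [hn.2]

end Literature.NumberTheory.LFunctions.Xiao2020
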